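import Summits.NavierStokesRegularity.NavierStokesRegularity.Theorems.PalasekTowerBreakdownLocalContinuationHolds
import Summits.NavierStokesRegularity.FluidComputer.PalasekTowerRegisterGlobalEnvelopeAtHolds
import Summits.NavierStokesRegularity.FluidComputer.PalasekTowerRegisterGlobalCeiling
import Summits.NavierStokesRegularity.FluidComputer.PalasekTowerRegisterGlobalHalvesAt
import Summits.NavierStokesRegularity.FluidComputer.PalasekTowerHeredityWitnessTower
import Summits.NavierStokesRegularity.FluidComputer.PalasekTowerStageSymmetry
import Summits.NavierStokesRegularity.FluidComputer.PalasekTowerHeredityRefutationWitnessesRung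

/-!
# NavierStokesRegularity — route `PalasekTowerBreakdown`: the child crux `HeredityFromTwo` with ONE
# rung at a generic level — it climbs the whole ladder (summit-bearing), so a CAPPED rung refutes it

Supports `stmt-NavierStokesRegularity-19250` (`PalasekTowerBreakdown.HeredityFromTwo := HeredityFrom 2`;
registered skeleton v2 `Cruxes/HeredityFromTwo/Lines/birth.lean`, stubs
`stub_apriori_ceiling : AprioriCeiling` / `stub_readout_floors : ReadoutFloors`, composition
`HeredityFromTwo_of`). Cell `ns-blowup`, seat `ns-palasek-19250-p1` (g0). LABEL: E–C typing + kernel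
bookkeeping (theorems only; no definition, no named fact, standard axioms). WHAT THIS IS NOT: not
Navier–Stokes evidence — no stage, flow or tower is constructed; the child crux is OPEN; every theorem
below takes the crux and/or a registered stage as a HYPOTHESIS.

The child quantifies over EVERY pinned (`Λ = 8`, `θ = 6/5`), rigid, quiet schedule on the wide-base
rates and EVERY globally anchored registered stage at EVERY level `k ≥ 2`. Consequences typed here, by
name against the route decl:

* §1 the LEVEL-INDEXED cut of record (ecbridge-7 g3 `heredityFrom_iff_forall_apriori_and_floors`,
  p442648; by name `palasekTowerBreakdown_heredityFromTwo_iff_aprioriAt_floorsAt`, ecbridge-1 g6):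
  `HeredityFromTwo ↔ ∀ k ≥ 2, AprioriCeilingAt k ∧ ReadoutFloorsAt k`, as doors — at each generic level
  the hand-over is «no overshoot of `c₂Y_{k+1}` by any finite-energy classical continuation» ∧ «the
  three level-`k+1` floors at `τ (k+1)`»; existence / regularity of the continuation is a theorem
  (`localContinuationAt_of_two_le`, `Theorems.palasekTowerBreakdown_localContinuationAt_holds`).
* §2 ONE RUNG AT A GENERIC LEVEL CLIMBS THE LADDER: `HeredityFromTwo` and ONE registered stage at
  SOME level `k₀ ≥ 2` of a pinned rigid quiet schedule `S` give a registered stage of `S` at EVERY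
  level (up by heredity, down by restriction — `Margins.antitone_routeG`), hence every rung `RungG K`,
  a `Realisation 1 TowerRates.wide` (`Schedule.nonempty_realisation_of_nonempty_stages`) and Clay (C)
  `NavierStokesBreakdownR3` (`navierStokesBreakdownR3_of_nonempty_stages`, W14-free PATH B′):
  **`palasekTowerBreakdown_breakdownR3_of_heredityFromTwo_rungG : HeredityFromTwo → (∃ k₀ ≥ 2, RungG k₀) → NavierStokesBreakdownR3`**.
  Reading: given the child, the first rung 19249 and the base 19179 are needed ONLY to manufacture
  `RungG 2` (`rungG_two_of_heredityAtOne`); any other source of a level-`≥ 2` rung closes (C) with the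
  child alone.
* §3 THE `∀`-FORM LEVER AT THE GENERIC LEVELS (tribunal T2 r3 supplement; planner g18 STATUS l.3948:
  «level-2/∀k needs only QUALITATIVE boundedness + a sterile level-2 stage»), typed: along the registered
  stages of such an `S` the readout speeds `‖u(τ_k, x_k)‖ ≥ Y_k` are UNBOUNDED
  (`palasekTowerBreakdown_heredityFromTwo_speed_unbounded`), so ANY all-time sup cap `M` on the
  registered stages of `S` — in particular any cap on the finite-energy classical solutions of `S`'s
  forced Cauchy problem on the slabs `[0, T'] ⊂ [0, S.T)` — together with ONE registered stage of `S` at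
  a level `k₀ ≥ 2` REFUTES the child (`palasekTowerBreakdown_not_heredityFromTwo_of_capped_stage`,
  `…_of_capped_cauchy`). No cap is asserted: for a general schedule none exists (that is the Clay
  problem); the lever bites only on a design whose symmetry class carries a printed cap.
* §4 STERILE CLASSES ARE HEREDITARY ALONG THE CHILD'S QUANTIFIERS (over `Stage.isAxisymmetric_of_schedule`
  / `Stage.hasNoSwirl_of_schedule`, p441581, and `IsClassicalNSSolutionOn.isAxisymmetric_of_clayForce` /
  `hasNoSwirl_of_clayForce`, p441018): for a schedule with axisymmetric swirl-free datum and force, EVERY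
  continuation `(u, p)` quantified in `AprioriCeilingAt k` / `ReadoutFloorsAt k` (classical on `[0, T']`,
  agreeing with the stage on `[0, τ k]`, finite energy) is axisymmetric without swirl on `[0, T']`, and
  the cap of §3 need only be known on axisymmetric swirl-free solutions
  (`palasekTowerBreakdown_not_heredityFromTwo_of_capped_noSwirl`). The printed cap for that class
  (Ladyzhenskaya 1968 / Ukhovskii–Yudovich 1968, global regularity of axisymmetric swirl-free flows) is
  NOT in the tree and is NOT used; the open precondition of the lever is a REGISTERED swirl-free stage at
  a level `≥ 2` (a `RungG`-type exhibit inside the sterile class, `exists_rungG_of_not_heredityFrom`).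

References: S. Palasek, arXiv:2605.13827 §3.3–§4 [cite: Palasek2026ElementaryModel, §4]; C. L. Fefferman,
Clay problem description, (C) [cite: FeffermanClay2006, (C)]; A. J. Majda, A. L. Bertozzi, *Vorticity and
Incompressible Flow* (CUP 2002), §2.3.3 [cite: MajdaBertozziCUP2002, §2.3.3]; T. Tao, Anal. PDE 6 (2013),
Cor. 11.4 [cite: Tao2011, Cor. 11.4].
-/

-- `Summit.<Summit>.<Problem>` is the tree's mandated summit-side namespace (CONVENTIONS §2); for this
-- single-conjunct summit the two coincide, so the duplicate is deliberate.
set_option linter.dupNamespace false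

noncomputable section

namespace Summit.NavierStokesRegularity.NavierStokesRegularity.Theorems

open Set MeasureTheory Filter Topology
open scoped ENNReal
open Summit.NavierStokesRegularity.NavierStokesRegularity.Theses
open Summit.NavierStokesRegularity.FluidComputer.PalasekTowerClayBridge
open Literature.Analysis.FluidPDE

/-! ## §1 The level-indexed cut of record, by name

The equivalence itself is the tree theorem `palasekTowerBreakdown_heredityFromTwo_iff_aprioriAt_floorsAt`
(`Theorems/PalasekTowerBreakdownLocalContinuationHolds.lean`, ecbridge-1 g6); here its two directions
as doors / projections. -/

/-- The level-indexed door: the a-priori ceiling and the readout floors AT every level `k ≥ 2` give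
the child crux BY NAME. [cite: Palasek2026ElementaryModel, §4] -/
theorem palasekTowerBreakdown_heredityFromTwo_of_forall_apriori_floors
    (hA : ∀ k : ℕ, 2 ≤ k → AprioriCeilingAt k) (hB : ∀ k : ℕ, 2 ≤ k → ReadoutFloorsAt k) :
    PalasekTowerBreakdown.HeredityFromTwo :=
  palasekTowerBreakdown_heredityFromTwo_iff_aprioriAt_floorsAt.2 fun k hk => ⟨hA k hk, hB k hk⟩

/-- The child gives the a-priori ceiling AT every level `k ≥ 2` (so refuting `AprioriCeilingAt k` for
ONE `k ≥ 2` refutes the child). [cite: Palasek2026ElementaryModel, §4] -/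
theorem palasekTowerBreakdown_heredityFromTwo_aprioriCeilingAt
    (h : PalasekTowerBreakdown.HeredityFromTwo) {k : ℕ} (hk : 2 ≤ k) : AprioriCeilingAt k :=
  ((palasekTowerBreakdown_heredityFromTwo_iff_aprioriAt_floorsAt.1 h) k hk).1

/-- The child gives the readout floors AT every level `k ≥ 2` (so refuting `ReadoutFloorsAt k` for ONE
`k ≥ 2` refutes the child). [cite: Palasek2026ElementaryModel, §4] -/
theorem palasekTowerBreakdown_heredityFromTwo_readoutFloorsAt
    (h : PalasekTowerBreakdown.HeredityFromTwo) {k : ℕ} (hk : 2 ≤ k) : ReadoutFloorsAt k :=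
  ((palasekTowerBreakdown_heredityFromTwo_iff_aprioriAt_floorsAt.1 h) k hk).2

/-! ## §2 One rung at a generic level climbs the whole ladder -/

section Ladder

variable {S : Schedule TowerRates.wide}

/-- **Up the ladder**: under the child, a registered stage of a pinned rigid quiet schedule at a level
`k₀ ≥ 2` yields a registered stage of the SAME schedule at every level `k ≥ k₀` (iterate the hand-over).
[cite: Palasek2026ElementaryModel, §4] -/
theorem palasekTowerBreakdown_heredityFromTwo_nonempty_stage_of_le
    (h : PalasekTowerBreakdown.HeredityFromTwo) (hP : S.Pins 8 (6 / 5)) (hR : S.Rigid) (hQ : S.Quiet)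
    {k₀ : ℕ} (hk₀ : 2 ≤ k₀) (s : Stage 1 TowerRates.wide S (Margins.routeG TowerRates.wide) k₀)
    {k : ℕ} (hk : k₀ ≤ k) :
    Nonempty (Stage 1 TowerRates.wide S (Margins.routeG TowerRates.wide) k) := by
  induction k, hk using Nat.le_induction with
  | base => exact ⟨s⟩
  | succ k hk ih =>
    obtain ⟨s'⟩ := ih
    obtain ⟨s'', -⟩ := h S hP hR hQ k (hk₀.trans hk) s'
    exact ⟨s''⟩

/-- **Down the ladder** (free): a registered stage at level `k₀` restricts to one at every level
`k ≤ k₀` — the route margin is level-antitone (`Margins.antitone_routeG`). [folklore] -/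
theorem palasekTowerBreakdown_nonempty_stage_of_ge {k₀ k : ℕ} (hk : k ≤ k₀)
    (s : Stage 1 TowerRates.wide S (Margins.routeG TowerRates.wide) k₀) :
    Nonempty (Stage 1 TowerRates.wide S (Margins.routeG TowerRates.wide) k) :=
  ⟨s.restrictOfAntitone (Margins.antitone_routeG TowerRates.wide) hk⟩

/-- **One rung at a generic level climbs the whole ladder**: under the child, ONE registered stage at
SOME level `k₀ ≥ 2` of a pinned rigid quiet schedule `S` gives a registered stage of `S` at EVERY level.
[cite: Palasek2026ElementaryModel, §4] -/
theorem palasekTowerBreakdown_heredityFromTwo_nonempty_stage_all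
    (h : PalasekTowerBreakdown.HeredityFromTwo) (hP : S.Pins 8 (6 / 5)) (hR : S.Rigid) (hQ : S.Quiet)
    {k₀ : ℕ} (hk₀ : 2 ≤ k₀) (s : Stage 1 TowerRates.wide S (Margins.routeG TowerRates.wide) k₀)
    (k : ℕ) : Nonempty (Stage 1 TowerRates.wide S (Margins.routeG TowerRates.wide) k) := by
  rcases le_total k₀ k with hk | hk
  · exact palasekTowerBreakdown_heredityFromTwo_nonempty_stage_of_le h hP hR hQ hk₀ s hk
  · exact palasekTowerBreakdown_nonempty_stage_of_ge hk s

/-- Hence, under the child, ONE rung at a level `≥ 2` gives EVERY rung `RungG K`.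
[cite: Palasek2026ElementaryModel, §4] -/
theorem palasekTowerBreakdown_heredityFromTwo_rungG_all (h : PalasekTowerBreakdown.HeredityFromTwo)
    (hK : ∃ k₀, 2 ≤ k₀ ∧ RungG k₀) (K : ℕ) : RungG K := by
  obtain ⟨k₀, hk₀, S, hP, hR, hQ, ⟨s⟩⟩ := hK
  exact ⟨S, hP, hR, hQ, palasekTowerBreakdown_heredityFromTwo_nonempty_stage_all h hP hR hQ hk₀ s K⟩

/-- In particular the BASE item 19179 (`EpisodeBaseG = RungG 1`) follows from the child and any rung at
a level `≥ 2`. [folklore] -/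
theorem palasekTowerBreakdown_episodeBase_of_heredityFromTwo_rungG
    (h : PalasekTowerBreakdown.HeredityFromTwo) (hK : ∃ k₀, 2 ≤ k₀ ∧ RungG k₀) :
    PalasekTowerBreakdown.EpisodeBase :=
  rungG_one_iff.1 (palasekTowerBreakdown_heredityFromTwo_rungG_all h hK 1)

/-- **The child plus one generic rung realises the tower**: a `Realisation 1 TowerRates.wide` from
`HeredityFromTwo` and ONE registered stage at a level `k₀ ≥ 2` of a pinned rigid quiet schedule (the
glued chain of that schedule's registered stages, `Schedule.nonempty_realisation_of_nonempty_stages`).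
[cite: Palasek2026ElementaryModel, §4] -/
theorem palasekTowerBreakdown_heredityFromTwo_realisation (h : PalasekTowerBreakdown.HeredityFromTwo)
    (hP : S.Pins 8 (6 / 5)) (hR : S.Rigid) (hQ : S.Quiet) {k₀ : ℕ} (hk₀ : 2 ≤ k₀)
    (s : Stage 1 TowerRates.wide S (Margins.routeG TowerRates.wide) k₀) :
    Nonempty (Realisation 1 TowerRates.wide) :=
  S.nonempty_realisation_of_nonempty_stages one_pos
    (palasekTowerBreakdown_heredityFromTwo_nonempty_stage_all h hP hR hQ hk₀ s)

/-- **THE CHILD PLUS ONE RUNG AT A GENERIC LEVEL IS SUMMIT-BEARING**: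
`HeredityFromTwo → (∃ k₀ ≥ 2, RungG k₀) → NavierStokesBreakdownR3` — Clay (C) through the one-design
door `navierStokesBreakdownR3_of_nonempty_stages` (W14-free PATH B′ closer). Given the child, the
first rung 19249 and the base 19179 serve only to manufacture `RungG 2`. Nothing is asserted: both
hypotheses are OPEN. [cite: FeffermanClay2006, (C)] -/
theorem palasekTowerBreakdown_breakdownR3_of_heredityFromTwo_rungG
    (h : PalasekTowerBreakdown.HeredityFromTwo) (hK : ∃ k₀, 2 ≤ k₀ ∧ RungG k₀) :
    NavierStokesBreakdownR3 := by
  obtain ⟨k₀, hk₀, S, hP, hR, hQ, ⟨s⟩⟩ := hK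
  exact navierStokesBreakdownR3_of_nonempty_stages one_pos
    (palasekTowerBreakdown_heredityFromTwo_nonempty_stage_all h hP hR hQ hk₀ s)

/-- The same with the route's first two items in place of the rung (re-derivation of the route's
deciding composition through the one-design door: `EpisodeBase → HeredityAtOne → HeredityFromTwo → (C)`).
[cite: FeffermanClay2006, (C)] -/
theorem palasekTowerBreakdown_breakdownR3_of_children (h₁ : PalasekTowerBreakdown.EpisodeBase)
    (h₂ : PalasekTowerBreakdown.HeredityAtOne) (h₃ : PalasekTowerBreakdown.HeredityFromTwo) :
    NavierStokesBreakdownR3 :=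
  palasekTowerBreakdown_breakdownR3_of_heredityFromTwo_rungG h₃
    ⟨2, le_rfl, rungG_two_of_heredityAtOne h₁ h₂⟩

end Ladder

/-! ## §3 The `∀`-form lever at the generic levels: a capped rung refutes the child -/

section Lever

variable {S : Schedule TowerRates.wide}

/-- **Under the child, the readout speeds along one design's registered stages are unbounded**: from
ONE registered stage at a level `k₀ ≥ 2` of a pinned rigid quiet schedule `S`, for every `M` some
registered stage of `S` at some level `k` reads a speed `> M` in the ball at `τ k` (`Y_k → ∞` and the
floor `c₁ Y_k`, `c₁ = 1`). All these readout times lie in `(0, S.T)`. [cite: Palasek2026ElementaryModel, §4] -/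
theorem palasekTowerBreakdown_heredityFromTwo_speed_unbounded
    (h : PalasekTowerBreakdown.HeredityFromTwo) (hP : S.Pins 8 (6 / 5)) (hR : S.Rigid) (hQ : S.Quiet)
    {k₀ : ℕ} (hk₀ : 2 ≤ k₀) (s : Stage 1 TowerRates.wide S (Margins.routeG TowerRates.wide) k₀)
    (M : ℝ) :
    ∃ (k : ℕ) (s' : Stage 1 TowerRates.wide S (Margins.routeG TowerRates.wide) k)
      (x : EuclideanSpace ℝ (Fin 3)), ‖x‖ ≤ S.radius ∧ M < ‖s'.u (S.τ k) x‖ := by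
  obtain ⟨k, hk⟩ := ((TowerRates.wide.tendsto_Y_atTop.eventually_gt_atTop M)).exists
  obtain ⟨s'⟩ := palasekTowerBreakdown_heredityFromTwo_nonempty_stage_all h hP hR hQ hk₀ s k
  obtain ⟨x, hx, hfl⟩ := s'.floor k le_rfl
  refine ⟨k, s', x, hx, lt_of_lt_of_le ?_ hfl⟩
  rw [hR.c₁_eq, one_mul]
  exact hk

/-- **A CAPPED RUNG AT A GENERIC LEVEL REFUTES THE CHILD** (stage form): if a pinned rigid quiet wide
schedule `S` carries a registered stage at some level `k₀ ≥ 2` and ALL registered stages of `S` (every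
level) obey one sup bound `‖u‖ ≤ M` on their slabs, then `¬ HeredityFromTwo`. No such `S` is asserted
to exist. [cite: Palasek2026ElementaryModel, §4] -/
theorem palasekTowerBreakdown_not_heredityFromTwo_of_capped_stage (hP : S.Pins 8 (6 / 5))
    (hR : S.Rigid) (hQ : S.Quiet) {k₀ : ℕ} (hk₀ : 2 ≤ k₀)
    (s : Stage 1 TowerRates.wide S (Margins.routeG TowerRates.wide) k₀) {M : ℝ}
    (hcap : ∀ (k : ℕ) (s' : Stage 1 TowerRates.wide S (Margins.routeG TowerRates.wide) k),
      ∀ t ∈ Icc 0 (S.τ k), ∀ x, ‖s'.u t x‖ ≤ M) :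
    ¬ PalasekTowerBreakdown.HeredityFromTwo := by
  intro h
  obtain ⟨k, s', x, -, hM⟩ := palasekTowerBreakdown_heredityFromTwo_speed_unbounded h hP hR hQ hk₀ s M
  exact absurd (hcap k s' (S.τ k) ⟨(S.τ_pos k).le, le_rfl⟩ x) (not_le.2 hM)

/-- **A CAPPED RUNG AT A GENERIC LEVEL REFUTES THE CHILD** (Cauchy-problem form): if a pinned rigid
quiet wide schedule `S` carries a registered stage at some level `k₀ ≥ 2`, and every finite-energy
classical solution of `S`'s forced Cauchy problem (force `S.f`, datum `S.u₀`, unit viscosity) on a closed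
slab `[0, T']`, `0 < T' < S.T`, is bounded by one `M` (a QUALITATIVE all-time cap before the schedule's
blow-up time), then `¬ HeredityFromTwo` — each registered stage of `S` is such a solution on `[0, τ k]`,
`τ k < S.T`. [cite: Palasek2026ElementaryModel, §4] -/
theorem palasekTowerBreakdown_not_heredityFromTwo_of_capped_cauchy (hP : S.Pins 8 (6 / 5))
    (hR : S.Rigid) (hQ : S.Quiet) {k₀ : ℕ} (hk₀ : 2 ≤ k₀)
    (s : Stage 1 TowerRates.wide S (Margins.routeG TowerRates.wide) k₀) {M : ℝ}
    (hcap : ∀ T' : ℝ, 0 < T' → T' < S.T →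
      ∀ (u : ℝ → EuclideanSpace ℝ (Fin 3) → EuclideanSpace ℝ (Fin 3))
        (p : ℝ → EuclideanSpace ℝ (Fin 3) → ℝ),
        IsClassicalNSSolutionOn (Icc 0 T') 1 S.f u p → u 0 = S.u₀ →
        (∃ C : ℝ≥0∞, C < ⊤ ∧ ∀ t ∈ Icc 0 T', ∫⁻ x, ‖u t x‖ₑ ^ 2 ≤ C) →
        ∀ t ∈ Icc 0 T', ∀ x, ‖u t x‖ ≤ M) :
    ¬ PalasekTowerBreakdown.HeredityFromTwo :=
  palasekTowerBreakdown_not_heredityFromTwo_of_capped_stage hP hR hQ hk₀ s fun k s' =>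
    hcap (S.τ k) (S.τ_pos k) (S.τ_lt_T k) s'.u s'.p s'.classical s'.initial s'.energy

/-- The same lever against the PARENT crux `EpisodeInduction` (which contains the child,
`EpisodeInductionG.heredityFrom`). [cite: Palasek2026ElementaryModel, §4] -/
theorem palasekTowerBreakdown_not_episodeInduction_of_capped_stage (hP : S.Pins 8 (6 / 5))
    (hR : S.Rigid) (hQ : S.Quiet) {k₀ : ℕ} (hk₀ : 2 ≤ k₀)
    (s : Stage 1 TowerRates.wide S (Margins.routeG TowerRates.wide) k₀) {M : ℝ}
    (hcap : ∀ (k : ℕ) (s' : Stage 1 TowerRates.wide S (Margins.routeG TowerRates.wide) k),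
      ∀ t ∈ Icc 0 (S.τ k), ∀ x, ‖s'.u t x‖ ≤ M) :
    ¬ PalasekTowerBreakdown.EpisodeInduction := fun h =>
  palasekTowerBreakdown_not_heredityFromTwo_of_capped_stage hP hR hQ hk₀ s hcap
    (EpisodeInductionG.heredityFrom h (by norm_num))

end Lever

/-! ## §4 Sterile symmetry classes are hereditary along the child's quantifiers -/

section Sterile

variable {S : Schedule TowerRates.wide} {k : ℕ}

/-- **Every continuation quantified in the child's halves inherits axisymmetry**: for a schedule with
axisymmetric datum and axisymmetric force (on all of `[0, ∞)`), a registered stage `s` at level `k`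
and ANY classical `(u, p)` on `[0, T']`, `τ k ≤ T'`, with the design force, agreeing with `s` on
`[0, τ k]` and of finite energy — exactly the objects `AprioriCeilingAt k` / `ReadoutFloorsAt k` /
`AprioriCeiling` / `ReadoutFloors` quantify over — `u t` is axisymmetric for every `t ∈ [0, T']`
(the continuation is a finite-energy classical solution from the `H¹` Clay datum `S.u₀`; symmetry
preservation under a Clay-class force, p441018). [cite: MajdaBertozziCUP2002, §2.3.3; Tao2011, Cor. 11.4] -/
theorem palasekTowerBreakdown_continuation_isAxisymmetric
    (s : Stage 1 TowerRates.wide S (Margins.routeG TowerRates.wide) k)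
    (h0A : IsAxisymmetric S.u₀) (hfA : ∀ t, 0 ≤ t → IsAxisymmetric (S.f t)) {T' : ℝ}
    (hT' : S.τ k ≤ T') {u : ℝ → EuclideanSpace ℝ (Fin 3) → EuclideanSpace ℝ (Fin 3)}
    {p : ℝ → EuclideanSpace ℝ (Fin 3) → ℝ} (hcl : IsClassicalNSSolutionOn (Icc 0 T') 1 S.f u p)
    (hag : ∀ t ∈ Icc 0 (S.τ k), u t = s.u t ∧ p t = s.p t)
    (hE : ∃ C : ℝ≥0∞, C < ⊤ ∧ ∀ t ∈ Icc 0 T', ∫⁻ x, ‖u t x‖ₑ ^ 2 ≤ C) :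
    ∀ t ∈ Icc 0 T', IsAxisymmetric (u t) := by
  have h0 : u 0 = S.u₀ := by
    rw [(hag 0 ⟨le_rfl, (S.τ_pos k).le⟩).1, s.initial]
  exact hcl.isAxisymmetric_of_clayForce one_pos ((S.τ_pos k).trans_le hT') s.memLp_datum.1
    s.memLp_datum.2 S.force_smooth S.force_decay h0 hE (fun t ht => hfA t ht.1) h0A

/-- **Every continuation quantified in the child's halves inherits «no swirl»**: same setting with
datum and force axisymmetric WITHOUT swirl — `u t` is axisymmetric without swirl for every
`t ∈ [0, T']`. So for a sterile (axisymmetric swirl-free) design the readout floors of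
`ReadoutFloorsAt k` would have to be met by a swirl-free field, and the no-overshoot bound of
`AprioriCeilingAt k` concerns swirl-free flows only. [cite: LemarieRieusset2016, §10.3 (10.20)–(10.21); Tao2011, Cor. 11.4] -/
theorem palasekTowerBreakdown_continuation_hasNoSwirl
    (s : Stage 1 TowerRates.wide S (Margins.routeG TowerRates.wide) k)
    (h0A : IsAxisymmetric S.u₀) (h0S : HasNoSwirl S.u₀) (hfA : ∀ t, 0 ≤ t → IsAxisymmetric (S.f t))
    (hfS : ∀ t, 0 ≤ t → HasNoSwirl (S.f t)) {T' : ℝ} (hT' : S.τ k ≤ T')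
    {u : ℝ → EuclideanSpace ℝ (Fin 3) → EuclideanSpace ℝ (Fin 3)}
    {p : ℝ → EuclideanSpace ℝ (Fin 3) → ℝ} (hcl : IsClassicalNSSolutionOn (Icc 0 T') 1 S.f u p)
    (hag : ∀ t ∈ Icc 0 (S.τ k), u t = s.u t ∧ p t = s.p t)
    (hE : ∃ C : ℝ≥0∞, C < ⊤ ∧ ∀ t ∈ Icc 0 T', ∫⁻ x, ‖u t x‖ₑ ^ 2 ≤ C) :
    ∀ t ∈ Icc 0 T', IsAxisymmetric (u t) ∧ HasNoSwirl (u t) := by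
  have h0 : u 0 = S.u₀ := by
    rw [(hag 0 ⟨le_rfl, (S.τ_pos k).le⟩).1, s.initial]
  have hT'0 : 0 < T' := (S.τ_pos k).trans_le hT'
  refine fun t ht => ⟨?_, ?_⟩
  · exact hcl.isAxisymmetric_of_clayForce one_pos hT'0 s.memLp_datum.1 s.memLp_datum.2
      S.force_smooth S.force_decay h0 hE (fun r hr => hfA r hr.1) h0A t ht
  · exact hcl.hasNoSwirl_of_clayForce one_pos hT'0 s.memLp_datum.1 s.memLp_datum.2 S.force_smooth
      S.force_decay h0 hE (fun r hr => hfA r hr.1) (fun r hr => hfS r hr.1) h0A h0S t ht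

/-- **Under the child, a sterile design's hand-over is read on swirl-free fields**: for a pinned
rigid quiet wide schedule with axisymmetric swirl-free datum and force, a registered stage at a level
`k ≥ 2` and ANY finite-energy classical continuation `(u, p)` to `τ (k+1)` inside the ceiling, the
child delivers the three level-`k+1` floors at `τ (k+1)` (`ReadoutFloorsAt k`) AND the continuation is
axisymmetric without swirl throughout `[0, τ (k+1)]` — the velocity floor `c₁Y_{k+1}`, the strain
floor `c₁A_{k+1}` and the `N_{k+1}`-core loop are then readouts of a swirl-free field (its vorticity
is purely azimuthal). [cite: Palasek2026ElementaryModel, §4; MajdaBertozziCUP2002, §2.3.3] -/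
theorem palasekTowerBreakdown_heredityFromTwo_noSwirl_floors
    (h : PalasekTowerBreakdown.HeredityFromTwo) (hP : S.Pins 8 (6 / 5)) (hR : S.Rigid) (hQ : S.Quiet)
    (h0A : IsAxisymmetric S.u₀) (h0S : HasNoSwirl S.u₀) (hfA : ∀ t, 0 ≤ t → IsAxisymmetric (S.f t))
    (hfS : ∀ t, 0 ≤ t → HasNoSwirl (S.f t)) (hk : 2 ≤ k)
    (s : Stage 1 TowerRates.wide S (Margins.routeG TowerRates.wide) k)
    {u : ℝ → EuclideanSpace ℝ (Fin 3) → EuclideanSpace ℝ (Fin 3)}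
    {p : ℝ → EuclideanSpace ℝ (Fin 3) → ℝ}
    (hcl : IsClassicalNSSolutionOn (Icc 0 (S.τ (k + 1))) 1 S.f u p)
    (hag : ∀ t ∈ Icc 0 (S.τ k), u t = s.u t ∧ p t = s.p t)
    (hE : ∃ C : ℝ≥0∞, C < ⊤ ∧ ∀ t ∈ Icc 0 (S.τ (k + 1)), ∫⁻ x, ‖u t x‖ₑ ^ 2 ≤ C)
    (hceil : ∀ t ∈ Icc 0 (S.τ (k + 1)), ∀ x, ‖u t x‖ ≤ S.c₂ * TowerRates.wide.Y (k + 1)) :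
    ((∃ x, ‖x‖ ≤ S.radius ∧ S.c₁ * TowerRates.wide.Y (k + 1) ≤ ‖u (S.τ (k + 1)) x‖) ∧
      (∃ x, ‖x‖ ≤ S.radius ∧
        S.c₁ * TowerRates.wide.A (k + 1) ≤ ‖fderiv ℝ (u (S.τ (k + 1))) x‖) ∧
      (∃ (x : EuclideanSpace ℝ (Fin 3)) (γ : ℝ → EuclideanSpace ℝ (Fin 3)),
        ‖x‖ ≤ S.radius ∧ ContDiff ℝ 1 γ ∧ γ 0 = γ 1 ∧
        (∀ σ ∈ Icc (0 : ℝ) 1, γ σ ∈ Metric.closedBall x (1 / TowerRates.wide.N (k + 1))) ∧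
        (∀ σ ∈ Icc (0 : ℝ) 1, ‖deriv γ σ‖ ≤ 8 * Real.pi / TowerRates.wide.N (k + 1)) ∧
        S.c₁ * TowerRates.wide.N (k + 1) ^ (TowerRates.wide.β - 2) ≤
          circulation (u (S.τ (k + 1))) γ)) ∧
    ∀ t ∈ Icc 0 (S.τ (k + 1)), IsAxisymmetric (u t) ∧ HasNoSwirl (u t) :=
  ⟨palasekTowerBreakdown_heredityFromTwo_readoutFloorsAt h hk S hP hR hQ s u p hcl hag hE hceil,
    palasekTowerBreakdown_continuation_hasNoSwirl s h0A h0S hfA hfS (S.τ_mono (Nat.le_succ k)) hcl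
      hag hE⟩

/-- **The lever in a sterile class**: if a pinned rigid quiet wide schedule `S` with axisymmetric
swirl-free datum and force carries a registered stage at some level `k₀ ≥ 2`, and the finite-energy
classical AXISYMMETRIC SWIRL-FREE solutions of `S`'s forced Cauchy problem on the slabs `[0, T']`,
`0 < T' < S.T`, obey one sup bound `M`, then `¬ HeredityFromTwo` (every registered stage of `S` is
axisymmetric swirl-free, `Stage.hasNoSwirl_of_schedule`, p441581). Neither the stage nor the cap is
asserted; the cap for this class is the printed global regularity of axisymmetric swirl-free flows
(not in the tree, not used). [cite: MajdaBertozziCUP2002, §2.3.3; Palasek2026ElementaryModel, §4] -/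
theorem palasekTowerBreakdown_not_heredityFromTwo_of_capped_noSwirl (hP : S.Pins 8 (6 / 5))
    (hR : S.Rigid) (hQ : S.Quiet) (h0A : IsAxisymmetric S.u₀) (h0S : HasNoSwirl S.u₀)
    (hfA : ∀ t, 0 ≤ t → IsAxisymmetric (S.f t)) (hfS : ∀ t, 0 ≤ t → HasNoSwirl (S.f t))
    {k₀ : ℕ} (hk₀ : 2 ≤ k₀) (s : Stage 1 TowerRates.wide S (Margins.routeG TowerRates.wide) k₀)
    {M : ℝ}
    (hcap : ∀ T' : ℝ, 0 < T' → T' < S.T →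
      ∀ (u : ℝ → EuclideanSpace ℝ (Fin 3) → EuclideanSpace ℝ (Fin 3))
        (p : ℝ → EuclideanSpace ℝ (Fin 3) → ℝ),
        IsClassicalNSSolutionOn (Icc 0 T') 1 S.f u p → u 0 = S.u₀ →
        (∃ C : ℝ≥0∞, C < ⊤ ∧ ∀ t ∈ Icc 0 T', ∫⁻ x, ‖u t x‖ₑ ^ 2 ≤ C) →
        (∀ t ∈ Icc 0 T', IsAxisymmetric (u t) ∧ HasNoSwirl (u t)) →
        ∀ t ∈ Icc 0 T', ∀ x, ‖u t x‖ ≤ M) :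
    ¬ PalasekTowerBreakdown.HeredityFromTwo :=
  palasekTowerBreakdown_not_heredityFromTwo_of_capped_stage hP hR hQ hk₀ s fun k s' =>
    hcap (S.τ k) (S.τ_pos k) (S.τ_lt_T k) s'.u s'.p s'.classical s'.initial s'.energy
      (s'.hasNoSwirl_of_schedule one_pos h0A h0S hfA hfS)

/-- **What a Negative-lane witness against the child must be, in a sterile class** (contrapositive
packaging of the lever with `exists_rungG_of_not_heredityFrom`, p439748): under the child, a pinned
rigid quiet wide schedule with axisymmetric swirl-free datum and force whose axisymmetric swirl-free
finite-energy classical solutions are sup-capped before `S.T` carries NO registered stage at ANY level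
`k ≥ 2` — the sterile class is then EMPTY at the generic levels (vacuity of the child there).
[cite: Palasek2026ElementaryModel, §4] -/
theorem palasekTowerBreakdown_heredityFromTwo_isEmpty_stage_of_capped_noSwirl
    (h : PalasekTowerBreakdown.HeredityFromTwo) (hP : S.Pins 8 (6 / 5)) (hR : S.Rigid) (hQ : S.Quiet)
    (h0A : IsAxisymmetric S.u₀) (h0S : HasNoSwirl S.u₀) (hfA : ∀ t, 0 ≤ t → IsAxisymmetric (S.f t))
    (hfS : ∀ t, 0 ≤ t → HasNoSwirl (S.f t)) {M : ℝ}
    (hcap : ∀ T' : ℝ, 0 < T' → T' < S.T →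
      ∀ (u : ℝ → EuclideanSpace ℝ (Fin 3) → EuclideanSpace ℝ (Fin 3))
        (p : ℝ → EuclideanSpace ℝ (Fin 3) → ℝ),
        IsClassicalNSSolutionOn (Icc 0 T') 1 S.f u p → u 0 = S.u₀ →
        (∃ C : ℝ≥0∞, C < ⊤ ∧ ∀ t ∈ Icc 0 T', ∫⁻ x, ‖u t x‖ₑ ^ 2 ≤ C) →
        (∀ t ∈ Icc 0 T', IsAxisymmetric (u t) ∧ HasNoSwirl (u t)) →
        ∀ t ∈ Icc 0 T', ∀ x, ‖u t x‖ ≤ M)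
    {k₀ : ℕ} (hk₀ : 2 ≤ k₀) :
    IsEmpty (Stage 1 TowerRates.wide S (Margins.routeG TowerRates.wide) k₀) :=
  ⟨fun s => palasekTowerBreakdown_not_heredityFromTwo_of_capped_noSwirl hP hR hQ h0A h0S hfA hfS hk₀
    s hcap h⟩

end Sterile

end Summit.NavierStokesRegularity.NavierStokesRegularity.Theorems

end
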